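import Summits.BirchSwinnertonDyer.Rank1Residual.X11b.Three.ClassRecordEP
import HarnessLib

/-!
# X11b at `p = 3` — the KOLY RECORD: the class record v4.5′ with atom A1 handed to the Kolyvagin road
# (cell `bsd-stepL`, seat `bsd-stepL-koly` g6; kernel K-1 of the planner's DESIGN `plan/K2KOLY/DESIGN.md` for the
# third rung-K2 route `KolyvaginRoadThree`; THEOREMS ONLY — no definition, no named fact, no `sorry`)

`Three.forall_bsdp_of_classRecord_v45'` (`ClassRecordEP.lean`, x11b3) decides `BSD(E,3)` at every X11b@3 pair from
twenty published named facts and the typed per-road inputs: road (a) `RegulatorNonvanishingAt W 3` on (ram) ∧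
non-split, road (b) the Hsieh-descent residual + H2 ∧ H3 on (ram) ∧ split, the (T2♯)∕(T2′) upper halves, road (d)
on ¬(ram) ∧ Surj, the corner. **Here the same record is re-plumbed POINTWISE with the Tamagawa trichotomy on
(ram):** on A1 = (ram) ∧ `3 ∤ ∏ c_ℓ` (1 116 TRUE-OPEN classes N < 5·10⁵, class-wide 248 943 — the Kolyvagin-road
locus of record, TARGET v1.29 ruling (R-ad)) a NEW binder `hA1 : ClassX11b W 3 → Ram W 3 → ¬ 3 ∣ ∏c → BSDp W 3`
decides — this is the conclusion the Kolyvagin road delivers (`Koly.ZhangAtThreeSharp` + McCallum + one odd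
Heegner datum: `Koly.ClassX11b.bsdp_three_of_kolyvaginClass_one_ne_zero_of_mccallum`,
`Theorems/ClassRecordThreeKolyvaginClose.lean`) —, and roads (a)/(b) are asked ONLY on (ram) ∧ `3 ∣ ∏c`
(binders `hReg`, `hHb` RESTRICTED by `3 ∣ W.tamagawaProduct`); everything else is v4.5′ verbatim (Hsieh descent
residual unrestricted, λ-supply = the tree theorem `lambdaSupplyAt₃`, `hEP` = the tree theorem
`GaloisImage.EP.localEulerPoincareCharacteristic_adicCompletion`, corner via `missingPPartAt_of_corner_*_of_inputs`).
No new mathematics: the proof is the base record's `by_cases` (`Three.forall_bsdp_of_classRecord`,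
`ClassRecordAtThree.lean` :269) with one more case split, each branch calling the SAME pointwise road lemma.
CONDITIONAL on every binder; nothing booked; O2 stays OPEN; no census word.
-/

noncomputable section

open scoped Classical

open WeierstrassCurve NumberField IsDedekindDomain Field Literature.NumberTheory.EllipticCurves
  Rat.HeightOneSpectrum
  Literature.NumberTheory.DiophantineGeometry
  Literature.NumberTheory.EllipticCurves.GreenbergSelmer
  Literature.NumberTheory.EllipticCurves.ModularForms
  Literature.NumberTheory.EllipticCurves.Rank1Residual
  Literature.NumberTheory.EllipticCurves.Rank1Residual.Typed
  Literature.NumberTheory.EllipticCurves.Wuthrich2014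
  Literature.NumberTheory.EllipticCurves.BalakrishnanEtAl2019
  Literature.NumberTheory.EllipticCurves.Skinner2016
  Literature.NumberTheory.EllipticCurves.SteinWuthrich2013
  Literature.NumberTheory.EllipticCurves.Disegni2020
  Literature.NumberTheory.EllipticCurves.BarriosEtAl2025
  Literature.NumberTheory.QuadraticFields.Quadratic
  Literature.NumberTheory.Automorphic
  Literature.NumberTheory.GaloisRepresentations Literature.NumberTheory.GaloisCohomology
  Summit.BirchSwinnertonDyer.Rank1Residual.X11b.AcSelmer
  Summit.BirchSwinnertonDyer.Rank1Residual.X11b.LocBridge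

namespace Summit.BirchSwinnertonDyer.Rank1Residual.X11b.Three

/-- **X11b at `p = 3`, WHOLE CLASS — the KOLY RECORD (kernel K-1 of route design `KolyvaginRoadThree`).**
For every `E/ℚ` (globally minimal model `W`) with `(E,3)` in class X11b: `BSD(E,3)` holds, GIVEN (i) the twenty
published named facts of the class record v4.5′ (`hGZ … hH`, as in `forall_bsdp_of_classRecord_v45'`); (ii) **the
Kolyvagin road on A1**: `hA1 : ClassX11b W 3 → Ram W 3 → ¬ 3 ∣ ∏c → BSDp W 3` (supplied by
`Koly.ZhangAtThreeSharp` + McCallum through the single-odd-datum consumer — route item `KolyGlueAtThree`); (iii)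
road (a) `RegulatorNonvanishingAt W 3` ONLY on (ram) ∧ non-split ∧ `3 ∣ ∏c` (`hReg`); (iv) road (b)'s named descent
residual `HsiehDescentAt₃ W` on (ram) ∧ split (`hDb`, as v4.5′) and its halves H2 ∧ H3 ONLY on (ram) ∧ split ∧
`3 ∣ ∏c` (`hHb`); (v) the (T2♯)∕(T2′)₃ binders `hSh hUα hUγ`, road (d) `hDd hHd hU₀` and the corner `hCL hCT hCU`
VERBATIM as v4.5′. Proof = the base record's pointwise case split (`by_cases` on (ram), on `3 ∣ ∏c`, on split, on
Surj) calling the same road lemmas (`bsdp_three_of_surj_of_stepLAt_of_shapes` with `StepLAt W` from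
`stepLAt_of_halves₃_of_classX11b` ∘ `bdpExistsAt₃_of_hsieh2014_of_descent` ∘ `lambdaSupplyAt₃`;
`bsdp_of_ram_of_nonsplit_of_regulatorNonvanishing`; `missingPPartAt_of_corner_*_of_inputs` with
`missingUpperBoundAt_of_cornerUpperAt`; `hEP` := `GaloisImage.EP.localEulerPoincareCharacteristic_adicCompletion`).
CONDITIONAL on every binder; nothing booked; O2 OPEN. [folklore]
[cite: Castella2018, Thm. 2.3 (p. 5), Thm. 3.2 (p. 9), §5 (p. 12)] [cite: Skinner2016PacificMC, Thm. A and Thm. C (§1)]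
[cite: McCallumLMS1991, §5 Cor. 5.6 (p. 310)] [cite: MatarNekovar2019, Thm. 0.3 (p. 456)] -/
theorem forall_bsdp_of_kolyRecord [Fact (Nat.Prime 3)]
    -- PUBLISHED: the named facts of route p2, WITHOUT `hEP` (as v4.5′)
    (hGZ : ∀ (N : ℕ) [NeZero N] (W : WeierstrassCurve ℚ) (K : Type) [Field K] [NumberField K],
      gross_zagier N W K)
    (hKo : ∀ (N : ℕ) [NeZero N] (W : WeierstrassCurve ℚ) (K : Type) [Field K] [NumberField K],
      kolyvagin N W K)
    (hB : ∀ (N : ℕ) [NeZero N] (W : WeierstrassCurve ℚ) (K : Type) [Field K] [NumberField K],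
      Kolyvagin1990_padicValNat_card_sha_le N W K)
    (hSk : Skinner2016.thmC_padicValRat_bsd_rank_zero) (hWu : sha_dvd_analyticSha)
    (hGZK : rank_eq_analyticRank_of_analyticRank_le_one) (hmod : hasEntireLFunction_rat)
    (hnf : exists_isNewformOf) (hHL : HoffsteinLuo1997_exists_twist_L_one_ne_zero)
    (hMaz : mazur_not_dvd_maninConstant_of_odd)
    (hPT : ∀ (K : Type) [Field K] [NumberField K], poitouTate_sum_localTatePairing_eq_zero K)
    (hFH : friedbergHoffstein_exists_twist_ne_zero_inertAt)
    (hBR : localTamagawaNumber_quadraticTwist_two_mem_of_goodReduction)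
    (hSkA : thmA_charIdeal_multiplicative) (hJn : thm61_nonsplitMultiplicative)
    (hHn : exists_isMultCanonical) (hD : thm1_padicBSD_rankOne_multiplicative)
    (hpar : nonempty_modularParametrizationData)
    (hMN : ∀ (N : ℕ) [NeZero N] (W : WeierstrassCurve ℚ) (K : Type) [Field K] [NumberField K],
      MatarNekovar2019.thm03_padicValNat_card_sha_le_of_irreducible N W K)
    (hH : hsieh2014_exists_anticyclotomicPAdicLFunction)
    -- THE KOLYVAGIN ROAD on A1 = (ram) ∧ 3 ∤ ∏c
    (hA1 : ∀ (W : WeierstrassCurve ℚ) [W.IsElliptic] [W.IsGloballyMinimal],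
      ClassX11b W 3 → Ram W 3 → ¬ 3 ∣ W.tamagawaProduct → BSDp W 3)
    -- ROAD (a) NONSPLIT(3) ∧ (ram) ∧ 3 ∣ ∏c: Schneider at 3, RESTRICTED to the Tamagawa cells
    (hReg : ∀ (W : WeierstrassCurve ℚ) [W.IsElliptic] [W.IsGloballyMinimal],
      ClassX11b W 3 → Ram W 3 → ¬ W.HasSplitMultiplicativeReductionAtPrime 3 → 3 ∣ W.tamagawaProduct →
        ClassClosure.RegulatorNonvanishingAt W 3)
    -- ROAD (b) SPLIT(3) ∧ (ram): the named descent residual (as v4.5′) …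
    (hDb : ∀ (W : WeierstrassCurve ℚ) [W.IsElliptic] [W.IsGloballyMinimal],
      ClassX11b W 3 → Ram W 3 → W.HasSplitMultiplicativeReductionAtPrime 3 → HsiehDescentAt₃ W)
    -- … and the halves H2 ∧ H3, RESTRICTED to the Tamagawa cells
    (hHb : ∀ (W : WeierstrassCurve ℚ) [W.IsElliptic] [W.IsGloballyMinimal],
      ClassX11b W 3 → Ram W 3 → W.HasSplitMultiplicativeReductionAtPrime 3 → 3 ∣ W.tamagawaProduct →
        BDPValueAt₃ W ∧ IMCDivAt₃ W)
    -- (T2♯-ℝ)₃ Shimura displays on split ∧ (ram) ∧ pure-β (as v4.5′)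
    (hSh : ∀ (W : WeierstrassCurve ℚ) [W.IsElliptic] [W.IsGloballyMinimal],
      ClassX11b W 3 → Ram W 3 → W.HasSplitMultiplicativeReductionAtPrime 3 → ¬ ShapeAlpha W →
        ¬ ShapeGamma W → 3 ∣ W.tamagawaProduct → P2ShimuraDisplaysAt W 3)
    -- (T2′)₃ Euler-system halves (as v4.5′)
    (hUα : ∀ (W : WeierstrassCurve ℚ) [W.IsElliptic] [W.IsGloballyMinimal],
      ClassX11b W 3 → Ram W 3 → ShapeAlpha W → Typed.MissingUpperBoundAt W 3)
    (hUγ : ∀ (W : WeierstrassCurve ℚ) [W.IsElliptic] [W.IsGloballyMinimal],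
      ClassX11b W 3 → Ram W 3 → W.HasSplitMultiplicativeReductionAtPrime 3 → ¬ ShapeAlpha W →
        ShapeGamma W → Typed.MissingUpperBoundAt W 3)
    -- ROAD (d) `¬Ram ∧ Surj` (as v4.5′)
    (hDd : ∀ (W : WeierstrassCurve ℚ) [W.IsElliptic] [W.IsGloballyMinimal],
      ClassX11b W 3 → ¬ Ram W 3 → Surj W 3 → HsiehDescentAt₃ W)
    (hHd : ∀ (W : WeierstrassCurve ℚ) [W.IsElliptic] [W.IsGloballyMinimal],
      ClassX11b W 3 → ¬ Ram W 3 → Surj W 3 → BDPValueAt₃ W ∧ IMCDivAt₃ W)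
    (hU₀ : ∀ (W : WeierstrassCurve ℚ) [W.IsElliptic] [W.IsGloballyMinimal],
      ClassX11b W 3 → Surj W 3 → ¬ Ram W 3 → Typed.MissingUpperBoundAt W 3)
    -- THE (T4″)@3 CORNER (as v4.5′)
    (hCL : ∀ (W : WeierstrassCurve ℚ) [W.IsElliptic] [W.IsGloballyMinimal], CornerStepLAt W)
    (hCT : ∀ (W : WeierstrassCurve ℚ) [W.IsElliptic] [W.IsGloballyMinimal], CornerTwistAt W)
    (hCU : ∀ (W : WeierstrassCurve ℚ) [W.IsElliptic] [W.IsGloballyMinimal], CornerUpperAt W)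
    (W : WeierstrassCurve ℚ) [W.IsElliptic] [W.IsGloballyMinimal] (hX : ClassX11b W 3) :
    BSDp W 3 := by
  have hEP : ∀ (K : Type) [Field K] [NumberField K] (v : HeightOneSpectrum (𝓞 K)),
      localEulerPoincareCharacteristic (v.adicCompletion K) :=
    GaloisImage.EP.localEulerPoincareCharacteristic_adicCompletion
  by_cases hram : Ram W 3
  · by_cases htam : 3 ∣ W.tamagawaProduct
    · by_cases hs : W.HasSplitMultiplicativeReductionAtPrime 3
      · -- road (b) on the Tamagawa cells: StepLAt W from the named descent residual + H2 ∧ H3 at W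
        have hL : StepLAt W :=
          stepLAt_of_halves₃_of_classX11b hnf hKo hPT hEP hX
            (bdpExistsAt₃_of_hsieh2014_of_descent W hH lambdaSupplyAt₃ (hDb W hX hram hs))
            (hHb W hX hram hs htam).1 (hHb W hX hram hs htam).2
        exact bsdp_three_of_surj_of_stepLAt_of_shapes hGZ hKo hB hSk hWu hGZK hmod hnf hHL hMaz hFH hBR
          hPT hEP W hX (surj_of_irr_of_ram W 3 hX.2.2.2 hram) hL
          (fun hram hα hγ ht ↦ hSh W hX hram hs hα hγ ht) (fun hram hα ↦ hUα W hX hram hα)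
          (fun hram hα hγ ↦ hUγ W hX hram hs hα hγ) (fun h ↦ absurd hram h)
      · -- road (a) on the Tamagawa cells
        exact bsdp_of_ram_of_nonsplit_of_regulatorNonvanishing hSkA hJn hHn hD hGZK hpar W 3 hX hram hs
          (hReg W hX hram hs htam)
    · -- A1: the Kolyvagin road decides
      exact hA1 W hX hram htam
  · by_cases hsurj : Surj W 3
    · -- road (d), as v4.5′
      have hL₀ : StepLAt W :=
        stepLAt_of_halves₃_of_classX11b hnf hKo hPT hEP hX
          (bdpExistsAt₃_of_hsieh2014_of_descent W hH lambdaSupplyAt₃ (hDd W hX hram hsurj))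
          (hHd W hX hram hsurj).1 (hHd W hX hram hsurj).2
      exact bsdp_three_of_surj_of_stepLAt_of_shapes hGZ hKo hB hSk hWu hGZK hmod hnf hHL hMaz hFH hBR
        hPT hEP W hX hsurj hL₀ (fun h _ _ _ ↦ absurd h hram) (fun h _ ↦ absurd h hram)
        (fun h _ _ ↦ absurd h hram) (fun _ ↦ hU₀ W hX hsurj hram)
    · -- the corner, as v4.1: the ℚ-level Euler-system half from (U♯) + (Tw), then the split dichotomy
      have hU : ∀ (W : WeierstrassCurve ℚ) [W.IsElliptic] [W.IsGloballyMinimal],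
          ClassX11b W 3 → ¬ Surj W 3 → 3 ∣ W.tamagawaProduct → Typed.MissingUpperBoundAt W 3 :=
        fun W _ _ hX hns ht ↦
          missingUpperBoundAt_of_cornerUpperAt hGZ hKo hGZK hmod hnf hHL hMaz W hX hns ht (hCU W) (hCT W)
      obtain ⟨hdvd, hnr⟩ := ClassX11b.dvd_and_not_ram_of_not_surj W 3 hX hsurj
      refine Typed.bsdp_of_missingPPartAt W 3 hGZK (by rw [hX.1]) ?_
      by_cases hs : W.HasSplitMultiplicativeReductionAtPrime 3
      · exact missingPPartAt_of_corner_split_of_inputs hGZ hKo hGZK hmod hnf hHL hMaz hPT hEP hMN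
          (fun W _ _ ↦ hCL W) (fun W _ _ ↦ hCT W) hU W hX hsurj hdvd hnr hs
      · exact missingPPartAt_of_corner_nonsplit_of_inputs hGZ hKo hGZK hmod hnf hHL hMaz hPT hEP hMN
          (fun W _ _ ↦ hCL W) (fun W _ _ ↦ hCT W) hU W hX hsurj hdvd hnr hs

end Summit.BirchSwinnertonDyer.Rank1Residual.X11b.Three

end
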